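import Literature.Geometry.Riemannian.ConjugateHeatKernelIntegrability
import HarnessLib

/-!
# The conjugate heat kernel of a Ricci flow is Lipschitz in the base point, locally uniformly in
# the other variables, hence jointly continuous (Bamler 2020a, §2.3: `K(x,t;y,s)` is smooth)

R. Bamler, *Entropy and heat kernel bounds on a Ricci flow background*, arXiv:2008.07093 (2020a),
§2.3 uses the heat kernel `K(x,t;y,s)` as a smooth function of all its arguments. The tree has,
for a `C^∞` family `h` of Riemannian metrics on a closed manifold `M` (modelled on `ℝᵐ`) which is
a Ricci flow on `[a, t]`, for EACH base point `x` a kernel `K(x,t;·,·)`, smooth on `M × (a, t)`,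
with `ν_{x,t;s} = K(x,t;·,s) dV_{h(s)}` (`IsRicciFlow.exists_conjugateHeatKernel`,
`RicciFlowConjugateHeatKernel.lean`). This file proves regularity ACROSS base points:

* `IsRicciFlow.exists_conjugateHeatKernel_family` — a family `K x` of such kernels which on every
  compact sub-slab `M × [a', b'] ⊂ M × (a, t)` is Lipschitz in `x` for `d_{h(t)}`:
  `|K x p − K x' p| ≤ L d_{h(t)}(x, x')`, and consequently `(x, p) ↦ K x p` is continuous on
  `M × (M × (a, t))`.

Proof: `K x − K x'` is a very weak solution of the time-reversed conjugate heat equation, so the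
uniform interior bound `sup |ũ| ≤ C ∫ |u|` (`exists_const_sup_le_integral_of_linearHeat_veryWeak`,
`LinearHeatVeryWeakUniformBound.lean`: hypoellipticity + closed graph) reduces the claim to an
`L¹` bound, and `∫ |K x − K x'|(·, s) dV_s = ‖ν_{x,t;s} − ν_{x',t;s}‖` is at most
`(π (t − s))^{-1/2} d_{h(t)}(x, x')` by the strong Feller bound of
`HeatKernelStrongFeller.lean` (Bamler 2020a, Thm. 4.1). Everything is proved; no definitions, no
named facts. Strict positivity of `K` follows in `ConjugateHeatKernelPositivity.lean`.

## References

* R. H. Bamler, *Entropy and heat kernel bounds on a Ricci flow background*, arXiv:2008.07093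
  (2020), §2.3, Thm. 4.1. [Bamler2020Entropy]
-/

noncomputable section

open Bundle Set Function Filter Manifold MeasureTheory Measure TopologicalSpace
open scoped Manifold ContDiff Topology ENNReal NNReal

namespace Literature.Geometry.Riemannian

open Lorentzian Lorentzian.PseudoRiemannianMetric

section Continuity

variable {m : ℕ} {H : Type*} [TopologicalSpace H]
  {I : ModelWithCorners ℝ (EuclideanSpace ℝ (Fin m)) H} [I.Boundaryless]
  {M : Type*} [TopologicalSpace M] [ChartedSpace H M] [IsManifold I ∞ M]
  [T2Space M] [CompactSpace M] [SecondCountableTopology M] [MeasurableSpace M] [BorelSpace M]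
  {h : ℝ → PseudoRiemannianMetric I ∞ (EuclideanSpace ℝ (Fin m)) (TangentSpace I : M → Type _)}
  {cov : ℝ → CovariantDerivative I (EuclideanSpace ℝ (Fin m)) (TangentSpace I : M → Type _)}
  (hh : IsContMDiffFamilyOn ∞ h univ) (hR : ∀ r, (h r).IsRiemannian)

/-- **The conjugate heat kernels of a Ricci flow, as a family over the base point, are Lipschitz
in the base point locally uniformly, and jointly continuous.** Let `h` be a `C^∞` family of
Riemannian metrics on the closed manifold `M` which is a Ricci flow `(h, cov)` on `[a, t]`, `a < t`.
There is a family `K x = K(x,t;·,·)`, `x ∈ M`, of functions `C^∞` and nonnegative on `M × (a, t)`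
with `ν_{x,t;s} = K x (·, s) dV_{h(s)}` for all `s ∈ (a, t)` and `∂ₛ(K x) = −Δ_{h(s)}(K x) + R (K x)`
there, such that for all `a < a' < b' < t` there is `L` with
`|K x p − K x' p| ≤ L · d_{h(t)}(x, x')` for all `x, x'` and `p ∈ M × [a', b']`, and
`(x, p) ↦ K x p` is continuous on `M × (M × (a, t))`. [cite: Bamler2020Entropy, §2.3] -/
theorem IsRicciFlow.exists_conjugateHeatKernel_family {a t : ℝ} (hat : a < t)
    (hflow : IsRicciFlow h cov (Icc a t)) :
    ∃ K : M → M × ℝ → ℝ,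
      (∀ x, ContMDiffOn (I.prod 𝓘(ℝ, ℝ)) 𝓘(ℝ, ℝ) ∞ (K x) (univ ×ˢ Ioo a t)) ∧
      (∀ x, ∀ p ∈ univ ×ˢ Ioo a t, 0 ≤ K x p) ∧
      (∀ x, ∀ s ∈ Ioo a t, heatKernelMeasure hh hR t x s =
        (h s).riemVolume.withDensity fun y ↦ ENNReal.ofReal (K x (y, s))) ∧
      (∀ x, ∀ p ∈ univ ×ˢ Ioo a t, deriv (fun s ↦ K x (p.1, s)) p.2 =
        -(h p.2).laplaceBeltrami (fun y ↦ K x (y, p.2)) p.1 +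
          (h p.2).scalarCurvatureWith (cov p.2) p.1 * K x p) ∧
      (∀ a' b', a < a' → a' < b' → b' < t → ∃ L : ℝ, ∀ (x x' : M), ∀ p ∈ univ ×ˢ Icc a' b',
        ENNReal.ofReal |K x p - K x' p| ≤ ENNReal.ofReal L * (h t).edist (hR t) x x') ∧
      ContinuousOn (fun q : M × (M × ℝ) ↦ K q.1 q.2) (univ ×ˢ (univ ×ˢ Ioo a t)) := by
  choose K hKs hK0 hKν hKpde hKweak using fun x ↦ hflow.exists_conjugateHeatKernel hh hR hat x
  -- the Lipschitz bound on a compact sub-slab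
  have hLip : ∀ a' b', a < a' → a' < b' → b' < t → ∃ L : ℝ, ∀ (x x' : M), ∀ p ∈ univ ×ˢ Icc a' b',
      ENNReal.ofReal |K x p - K x' p| ≤ ENNReal.ofReal L * (h t).edist (hR t) x x' := by
    intro a' b' haa' ha'b' hb't
    -- a slightly larger open slab `M × (a, b'')`, `b' < b'' < t`, still away from `t`
    set b'' : ℝ := (b' + t) / 2 with hb''
    have hb'b'' : b' < b'' := by rw [hb'']; linarith
    have hb''t : b'' < t := by rw [hb'']; linarith
    -- reversed setting and the uniform bound of `LinearHeatVeryWeakUniformBound.lean`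
    set μ₀ : Measure M := (h 0).riemVolume with hμ₀
    haveI : IsFiniteMeasure μ₀ := ⟨(h 0).riemVolume_univ_lt_top⟩
    have hh' : IsContMDiffFamilyOn ∞ (fun σ ↦ h (-σ)) univ := IsContMDiffFamilyOn.comp_neg hh
    have hR' : ∀ σ, (h (-σ)).IsRiemannian := fun σ ↦ hR _
    set ρ : M × ℝ → ℝ := fun p ↦ (h (-p.2)).densityRatio (h 0) p.1 with hρ
    have hρs : ContMDiff (I.prod 𝓘(ℝ, ℝ)) 𝓘(ℝ, ℝ) ∞ ρ := contMDiff_densityRatio_comp_neg hh hR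
    have hρpos : ∀ p, 0 < ρ p := fun p ↦ densityRatio_pos (hR _) (hR 0) _
    obtain ⟨C, hC⟩ := exists_const_sup_le_integral_of_linearHeat_veryWeak (h := fun σ ↦ h (-σ))
      (g₀ := h 0) (Q := fun σ y ↦ deriv (fun s ↦ (h (-s)).densityRatio (h 0) y) σ /
        (h (-σ)).densityRatio (h 0) y) hh' hR' (hR 0) (contMDiff_deriv_densityRatio_div hh hR)
      (a := -b'') (a' := -b') (b' := -a') (b := -a) (by linarith) (by linarith) (by linarith)
    -- the sets
    set O : Set (M × ℝ) := univ ×ˢ Ioo (-b'') (-a) with hO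
    have hOm : MeasurableSet O := MeasurableSet.univ.prod measurableSet_Ioo
    have hOsub : O ⊆ univ ×ˢ Ioo (-t) (-a) := prod_mono le_rfl (Ioo_subset_Ioo (by linarith) le_rfl)
    set ν : Measure (M × ℝ) := μ₀.prod (volume : Measure ℝ) with hν
    -- the reversed kernels `w x p = K x (p.1, -p.2)`: continuous, nonnegative, integrable on `O`
    set w : M → M × ℝ → ℝ := fun x p ↦ K x (p.1, -p.2) with hw
    have hmapsO : ∀ p ∈ O, (p.1, -p.2) ∈ (univ : Set M) ×ˢ Ioo a t := by
      rintro ⟨y, σ⟩ ⟨-, hσ⟩; exact ⟨mem_univ _, by linarith [hσ.2], by linarith [hσ.1]⟩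
    have hwc : ∀ x, ContinuousOn (w x) O := fun x ↦
      (hKs x).continuousOn.comp (continuous_fst.prodMk continuous_snd.neg).continuousOn hmapsO
    have hw0 : ∀ x, ∀ p ∈ O, 0 ≤ w x p := fun x p hp ↦ hK0 x _ (hmapsO p hp)
    have hwi : ∀ x, IntegrableOn (w x) O ν := by
      intro x
      refine integrableOn_reversedDensity hh hR (by linarith) (hwc x) (hw0 x) fun σ hσ ↦ ?_
      have hs : -σ ∈ Ioo a t := ⟨by linarith [hσ.2], by linarith [hσ.1]⟩
      show ((h (-σ)).riemVolume.withDensity fun y ↦ ENNReal.ofReal (K x (y, -σ))) univ ≤ 1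
      rw [← hKν x (-σ) hs, measure_univ]
    -- `ρ ≥ c > 0` on `O`
    obtain ⟨c, hc, hcρ⟩ : ∃ c, 0 < c ∧ ∀ p ∈ O, c ≤ ρ p := by
      rcases isEmpty_or_nonempty M with hM | hM
      · exact ⟨1, one_pos, fun p _ ↦ (IsEmpty.false p.1).elim⟩
      obtain ⟨p₀, -, hp₀⟩ := (isCompact_univ.prod (isCompact_Icc (a := -b'') (b := -a))).exists_isMinOn
        ⟨((Classical.arbitrary M), -b''), mem_univ _, le_rfl, by linarith⟩ hρs.continuous.continuousOn
      exact ⟨ρ p₀, hρpos p₀, fun p hp ↦ hp₀ ⟨mem_univ _, Ioo_subset_Icc_self hp.2⟩⟩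
    -- the uniform strong Feller constant on `O`: `t - s ≥ t - b''`
    set κ₀ : ℝ := 1 / Real.sqrt (Real.pi * (t - b'')) with hκ₀
    have hκ₀pos : 0 < κ₀ := by have := sub_pos.2 hb''t; positivity
    set L : ℝ := max C 0 * (1 / c * (κ₀ * (b'' - a))) + 1 with hLdef
    have hLpos : 0 < L := by have : 0 ≤ max C 0 * (1 / c * (κ₀ * (b'' - a))) := by
      { have := sub_pos.2 (haa'.trans (ha'b'.trans hb'b'')); positivity }; linarith
    refine ⟨L, fun x x' p hp ↦ ?_⟩
    set d : ℝ≥0∞ := (h t).edist (hR t) x x' with hd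
    rcases eq_or_ne d ⊤ with hdt | hdt
    · rw [hdt, ENNReal.mul_top (by simpa using hLpos)]; exact le_top
    -- the `L¹(O)` bound: `∫_O |w x − w x'| dν ≤ (1/c) κ₀ (b'' − a) d`
    have hL1 : ∫ q in O, |w x q - w x' q| ∂ν ≤ 1 / c * (κ₀ * (b'' - a)) * d.toReal := by
      have hint : IntegrableOn (fun q ↦ w x q - w x' q) O ν := (hwi x).sub (hwi x')
      -- slice bound at `σ ∈ (-b'', -a)`
      have hslice : ∀ σ ∈ Ioo (-b'') (-a), ∫ y, |w x (y, σ) - w x' (y, σ)| ∂μ₀ ≤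
          1 / c * (κ₀ * d.toReal) := by
        intro σ hσ
        have hs : -σ ∈ Ioo a t := ⟨by linarith [hσ.2], by linarith [hσ.1]⟩
        have hsb : -σ < b'' := by linarith [hσ.1]
        have hKc : ∀ z, Continuous fun y ↦ K z (y, -σ) := fun z ↦
          ((hKs z).continuousOn.comp_continuous (continuous_id.prodMk continuous_const)
            fun y ↦ ⟨mem_univ _, hs⟩ :)
        have hK0' : ∀ z y, 0 ≤ K z (y, -σ) := fun z y ↦ hK0 z _ ⟨mem_univ _, hs⟩
        -- total variation bound at time `-σ` with the flow restricted to `[-σ, t]`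
        have hTV := (hflow.mono (Icc_subset_Icc hs.1.le le_rfl)).ofReal_integral_abs_sub_le hh hR
          hs.2 (hKc x) (hKc x') (hK0' x) (hK0' x') (hKν x (-σ) hs) (hKν x' (-σ) hs)
        rw [← hd, ← ENNReal.ofReal_toReal hdt, ← ENNReal.ofReal_mul' ENNReal.toReal_nonneg,
          ENNReal.ofReal_le_ofReal_iff (by positivity)] at hTV
        have hκ : 1 / Real.sqrt (Real.pi * (t - -σ)) ≤ κ₀ := by
          rw [hκ₀]
          apply div_le_div_of_nonneg_left zero_le_one (by have := sub_pos.2 hb''t; positivity)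
          exact Real.sqrt_le_sqrt (by nlinarith [Real.pi_pos])
        -- `∫ |Δ| dμ₀ ≤ (1/c) ∫ |Δ| ρ dμ₀ = (1/c) ∫ |Δ| dV_{h(-σ)} ≤ (1/c) κ₀ d`
        have hρσc : Continuous fun y ↦ ρ (y, σ) := hρs.continuous.comp (continuous_id.prodMk continuous_const)
        have hΔc : Continuous fun y ↦ |w x (y, σ) - w x' (y, σ)| := ((hKc x).sub (hKc x')).abs
        have hΔi : Integrable (fun y ↦ |w x (y, σ) - w x' (y, σ)|) μ₀ :=
          hΔc.integrable_of_hasCompactSupport (HasCompactSupport.of_compactSpace _)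
        have hΔρi : Integrable (fun y ↦ 1 / c * (|w x (y, σ) - w x' (y, σ)| * ρ (y, σ))) μ₀ :=
          ((hΔc.mul hρσc).integrable_of_hasCompactSupport (HasCompactSupport.of_compactSpace _)).const_mul _
        calc ∫ y, |w x (y, σ) - w x' (y, σ)| ∂μ₀
            ≤ ∫ y, 1 / c * (|w x (y, σ) - w x' (y, σ)| * ρ (y, σ)) ∂μ₀ := by
              refine integral_mono hΔi hΔρi fun y ↦ ?_
              have hρy : 1 ≤ ρ (y, σ) / c := by
                rw [le_div_iff₀ hc, one_mul]; exact hcρ (y, σ) ⟨mem_univ _, hσ⟩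
              calc |w x (y, σ) - w x' (y, σ)| = |w x (y, σ) - w x' (y, σ)| * 1 := (mul_one _).symm
                _ ≤ |w x (y, σ) - w x' (y, σ)| * (ρ (y, σ) / c) :=
                    mul_le_mul_of_nonneg_left hρy (abs_nonneg _)
                _ = 1 / c * (|w x (y, σ) - w x' (y, σ)| * ρ (y, σ)) := by ring
          _ = 1 / c * ∫ y, |w x (y, σ) - w x' (y, σ)| ∂(h (-σ)).riemVolume := by
              rw [integral_const_mul, integral_riemVolume_eq_integral_mul_densityRatio (hR (-σ)) (hR 0)]
          _ ≤ 1 / c * (κ₀ * d.toReal) := by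
              gcongr
              exact hTV.trans (mul_le_mul_of_nonneg_right hκ ENNReal.toReal_nonneg)
      -- integrate the slice bound over `σ ∈ (-b'', -a)`
      have hprod : ν.restrict O = μ₀.prod (volume.restrict (Ioo (-b'') (-a))) := by
        rw [hν, hO, ← Measure.prod_restrict, Measure.restrict_univ]
      have hint' : Integrable (fun q : M × ℝ ↦ |w x q - w x' q|)
          (μ₀.prod (volume.restrict (Ioo (-b'') (-a)))) := by
        rw [← hprod]; exact hint.abs
      rw [show (∫ q in O, |w x q - w x' q| ∂ν) = ∫ q, |w x q - w x' q| ∂(ν.restrict O) from rfl,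
        hprod, integral_prod_symm _ hint']
      calc ∫ σ, ∫ y, |w x (y, σ) - w x' (y, σ)| ∂μ₀ ∂(volume.restrict (Ioo (-b'') (-a)))
          ≤ ∫ _σ, 1 / c * (κ₀ * d.toReal) ∂(volume.restrict (Ioo (-b'') (-a))) := by
            refine integral_mono_of_nonneg (Eventually.of_forall fun σ ↦ integral_nonneg fun y ↦
              abs_nonneg _) (integrable_const _) ?_
            exact (ae_restrict_mem measurableSet_Ioo).mono fun σ hσ ↦ hslice σ hσ
        _ = 1 / c * (κ₀ * (b'' - a)) * d.toReal := by
            rw [integral_const, measureReal_restrict_apply_univ,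
              Real.volume_real_Ioo_of_le (by linarith), smul_eq_mul]
            ring
    -- the uniform bound applied to `u = w x - w x'`
    set vfun : M × ℝ → ℝ := fun q ↦ w x q - w x' q with hvfun
    have hvc : ContinuousOn vfun O := (hwc x).sub (hwc x')
    have hvi : IntegrableOn vfun O ν := (hwi x).sub (hwi x')
    have hvm : AEStronglyMeasurable vfun (ν.restrict O) := hvc.aestronglyMeasurable hOm
    set u' : M × ℝ → ℝ := hvm.mk vfun with hu'
    have hu'm : Measurable u' := hvm.stronglyMeasurable_mk.measurable
    have hvu' : ∀ᵐ q ∂ν, q ∈ O → vfun q = u' q := (ae_restrict_iff' (μ := ν) hOm).1 hvm.ae_eq_mk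
    have hu'i : IntegrableOn u' O ν := hvi.congr hvm.ae_eq_mk
    -- the bracket (reversed family) and the very weak equation of `u'`
    have hQs := contMDiff_deriv_densityRatio_div hh hR
    have hweak' : ∀ ζ : M × ℝ → ℝ, ContMDiff (I.prod 𝓘(ℝ, ℝ)) 𝓘(ℝ, ℝ) ∞ ζ → HasCompactSupport ζ →
        tsupport ζ ⊆ O →
        ∫ q, u' q * (-(deriv (fun s ↦ (h (-s)).densityRatio (h 0) q.1 * ζ (q.1, s)) q.2) -
            (h (-q.2)).densityRatio (h 0) q.1 * (h (-q.2)).laplaceBeltrami (fun y ↦ ζ (y, q.2)) q.1 +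
            (h (-q.2)).densityRatio (h 0) q.1 *
              (deriv (fun s ↦ (h (-s)).densityRatio (h 0) q.1) q.2 /
                (h (-q.2)).densityRatio (h 0) q.1) * ζ q) ∂ν = 0 := by
      intro ζ h1 h2 h3
      set B : M × ℝ → ℝ := fun q ↦ -(deriv (fun s ↦ (h (-s)).densityRatio (h 0) q.1 * ζ (q.1, s)) q.2) -
          (h (-q.2)).densityRatio (h 0) q.1 * (h (-q.2)).laplaceBeltrami (fun y ↦ ζ (y, q.2)) q.1 +
          (h (-q.2)).densityRatio (h 0) q.1 *
            (deriv (fun s ↦ (h (-s)).densityRatio (h 0) q.1) q.2 /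
              (h (-q.2)).densityRatio (h 0) q.1) * ζ q with hB
      have hBc : Continuous B := continuous_heatBracket (g := fun σ ↦ h (-σ)) (g₀ := h 0)
        (Q := fun σ y ↦ deriv (fun s ↦ (h (-s)).densityRatio (h 0) y) σ / (h (-σ)).densityRatio (h 0) y)
        hh' hR' (hR 0) hQs h1
      obtain ⟨CB, hCB⟩ := exists_bound_heatBracket (g := fun σ ↦ h (-σ)) (g₀ := h 0)
        (Q := fun σ y ↦ deriv (fun s ↦ (h (-s)).densityRatio (h 0) y) σ / (h (-σ)).densityRatio (h 0) y)
        hh' hR' (hR 0) hQs h1 h2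
      have hB0 : ∀ q ∉ tsupport ζ, B q = 0 := fun q hq ↦
        heatAdjoint_eq_zero_of_notMem_tsupport (h := fun σ ↦ h (-σ)) (g₀ := h 0)
          (Q := fun σ y ↦ deriv (fun s ↦ (h (-s)).densityRatio (h 0) y) σ / (h (-σ)).densityRatio (h 0) y) hq
      show ∫ q, u' q * B q ∂ν = 0
      -- `u' B = vfun B` a.e. (on `O`, and both vanish off `tsupport ζ ⊆ O`)
      have hae : (fun q ↦ u' q * B q) =ᵐ[ν] fun q ↦ vfun q * B q := by
        filter_upwards [hvu'] with q hq
        by_cases hqζ : q ∈ tsupport ζ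
        · rw [hq (h3 hqζ)]
        · simp [hB0 q hqζ]
      rw [integral_congr_ae hae]
      -- `∫ (w x - w x') B = ∫ w x B - ∫ w x' B = 0 - 0`
      have hwBi : ∀ z, Integrable (fun q ↦ w z q * B q) ν := by
        intro z
        have hsupp : support (fun q ↦ w z q * B q) ⊆ O := fun q hq ↦
          h3 (by by_contra h'; exact hq (by simp [hB0 q h']))
        rw [← integrableOn_iff_integrable_of_support_subset hsupp]
        exact (hwi z).mul_bdd hBc.aestronglyMeasurable
          (Eventually.of_forall fun q ↦ by rw [Real.norm_eq_abs]; exact hCB q)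
      have e : (fun q ↦ vfun q * B q) = fun q ↦ w x q * B q - w x' q * B q := by
        funext q; simp only [hvfun]; ring
      rw [e, integral_sub (hwBi x) (hwBi x'), hKweak x ζ h1 h2 (h3.trans hOsub),
        hKweak x' ζ h1 h2 (h3.trans hOsub), sub_zero]
    have hq : (p.1, -p.2) ∈ (univ : Set M) ×ˢ Icc (-b') (-a') := ⟨mem_univ _, by
      have := hp.2; constructor <;> linarith [this.1, this.2]⟩
    have hbound := hC u' vfun hu'm hu'i hweak' hvc (hvu'.mono fun q h hq ↦ (h hq).symm) _ hq
    -- `|K x p - K x' p| = |vfun (p.1, -p.2)| ≤ C ∫_O |u'| = C ∫_O |vfun| ≤ ...`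
    have hvp : vfun (p.1, -p.2) = K x p - K x' p := by simp [hvfun, hw]
    have hIu : ∫ q in O, |u' q| ∂ν = ∫ q in O, |vfun q| ∂ν :=
      integral_congr_ae (hvm.ae_eq_mk.mono fun q hq ↦ by
        show |u' q| = |vfun q|
        rw [hu']; exact congrArg _ hq.symm)
    rw [hvp, hIu] at hbound
    have hreal : |K x p - K x' p| ≤ L * d.toReal := by
      have hI0 : 0 ≤ ∫ q in O, |vfun q| ∂ν := integral_nonneg fun q ↦ abs_nonneg _
      calc |K x p - K x' p| ≤ C * ∫ q in O, |vfun q| ∂ν := hbound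
        _ ≤ max C 0 * ∫ q in O, |vfun q| ∂ν := mul_le_mul_of_nonneg_right (le_max_left _ _) hI0
        _ ≤ max C 0 * (1 / c * (κ₀ * (b'' - a)) * d.toReal) :=
            mul_le_mul_of_nonneg_left hL1 (le_max_right _ _)
        _ ≤ L * d.toReal := by
            rw [hLdef, ← mul_assoc, add_mul, one_mul]
            linarith [ENNReal.toReal_nonneg (a := d)]
    calc ENNReal.ofReal |K x p - K x' p| ≤ ENNReal.ofReal (L * d.toReal) := ENNReal.ofReal_le_ofReal hreal
      _ = ENNReal.ofReal L * d := by rw [ENNReal.ofReal_mul' ENNReal.toReal_nonneg, ENNReal.ofReal_toReal hdt]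
  refine ⟨K, hKs, hK0, hKν, hKpde, hLip, ?_⟩
  -- joint continuity from the Lipschitz bound and the continuity of each `K x`
  rintro ⟨x₀, y₀, s₀⟩ ⟨-, -, hs₀⟩
  obtain ⟨L, hL⟩ := hLip ((a + s₀) / 2) ((s₀ + t) / 2) (by linarith [hs₀.1]) (by linarith [hs₀.1, hs₀.2])
    (by linarith [hs₀.2])
  have hLnn : ∀ (x x' : M) p, p ∈ univ ×ˢ Icc ((a + s₀) / 2) ((s₀ + t) / 2) →
      ENNReal.ofReal |K x p - K x' p| ≤ ENNReal.ofReal (max L 0) * (h t).edist (hR t) x x' :=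
    fun x x' p hp ↦ (hL x x' p hp).trans (by gcongr; exact le_max_left _ _)
  rw [ContinuousWithinAt, Metric.tendsto_nhds]
  intro ε hε
  -- continuity of `K x₀` at `(y₀, s₀)`
  have h1 : ∀ᶠ q in 𝓝[univ ×ˢ (univ ×ˢ Ioo a t)] ((x₀, y₀, s₀) : M × (M × ℝ)),
      dist (K x₀ q.2) (K x₀ (y₀, s₀)) < ε / 2 := by
    have hc : ContinuousWithinAt (K x₀) (univ ×ˢ Ioo a t) (y₀, s₀) := hKs x₀ |>.continuousOn _ ⟨mem_univ _, hs₀⟩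
    have := (Metric.tendsto_nhds.1 hc) (ε / 2) (half_pos hε)
    have hmap : Tendsto (fun q : M × (M × ℝ) ↦ q.2) (𝓝[univ ×ˢ (univ ×ˢ Ioo a t)] (x₀, y₀, s₀))
        (𝓝[univ ×ˢ Ioo a t] (y₀, s₀)) :=
      tendsto_nhdsWithin_of_tendsto_nhds_of_eventually_within _
        ((continuous_snd.tendsto _).mono_left nhdsWithin_le_nhds)
        (eventually_nhdsWithin_of_forall fun q hq ↦ hq.2)
    exact hmap.eventually this
  -- the Lipschitz term: `d_t(x, x₀) → 0` and `q.2` stays in the compact sub-slab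
  have h2 : ∀ᶠ q in 𝓝[univ ×ˢ (univ ×ˢ Ioo a t)] ((x₀, y₀, s₀) : M × (M × ℝ)),
      ENNReal.ofReal (max L 0) * (h t).edist (hR t) q.1 x₀ < ENNReal.ofReal (ε / 2) ∧
        q.2 ∈ univ ×ˢ Icc ((a + s₀) / 2) ((s₀ + t) / 2) := by
    have hd : Tendsto (fun q : M × (M × ℝ) ↦ ENNReal.ofReal (max L 0) * (h t).edist (hR t) q.1 x₀)
        (𝓝 (x₀, y₀, s₀)) (𝓝 0) := by
      have := (PseudoRiemannianMetric.tendsto_edist_nhds (hR t) x₀).comp (continuous_fst.tendsto (x₀, y₀, s₀))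
      simp only [Function.comp_def] at this
      have h0 : Tendsto (fun q : M × (M × ℝ) ↦ ENNReal.ofReal (max L 0) * (h t).edist (hR t) x₀ q.1)
          (𝓝 (x₀, y₀, s₀)) (𝓝 0) := by
        simpa using ENNReal.Tendsto.const_mul this (Or.inr ENNReal.ofReal_ne_top)
      refine h0.congr fun q ↦ ?_
      rw [PseudoRiemannianMetric.edist_comm]
    have hA : ∀ᶠ q in 𝓝 ((x₀, y₀, s₀) : M × (M × ℝ)),
        ENNReal.ofReal (max L 0) * (h t).edist (hR t) q.1 x₀ < ENNReal.ofReal (ε / 2) :=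
      hd (Iio_mem_nhds (by simpa using half_pos hε))
    have hB : ∀ᶠ q in 𝓝 ((x₀, y₀, s₀) : M × (M × ℝ)), q.2.2 ∈ Icc ((a + s₀) / 2) ((s₀ + t) / 2) :=
      (continuous_snd.snd.tendsto _).eventually (Icc_mem_nhds (by linarith [hs₀.1]) (by linarith [hs₀.2]))
    exact eventually_nhdsWithin_of_eventually_nhds ((hA.and hB).mono fun q hq ↦
      ⟨hq.1, mem_univ _, hq.2⟩)
  filter_upwards [h1, h2] with q hq1 hq2
  obtain ⟨x, p⟩ := q
  have hxp : ENNReal.ofReal |K x p - K x₀ p| < ENNReal.ofReal (ε / 2) :=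
    (hLnn x x₀ p hq2.2).trans_lt hq2.1
  rw [ENNReal.ofReal_lt_ofReal_iff (half_pos hε)] at hxp
  rw [Real.dist_eq] at hq1 ⊢
  calc |K x p - K x₀ (y₀, s₀)| ≤ |K x p - K x₀ p| + |K x₀ p - K x₀ (y₀, s₀)| := abs_sub_le _ _ _
    _ < ε := by linarith

end Continuity

end Literature.Geometry.Riemannian
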